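import Mathlib
import HarnessLib
import Summits.NavierStokesRegularity.NavierStokesRegularity.Theses.AxisymmetricExtremality
import Literature.Analysis.FluidPDE.SelfSimilarLiouville

/-!
# Strategist s3 census sketch for `AxisymmetricKatoGlobal` (stmt-NavierStokesRegularity-15453)

Typed versions of the census attempts (weaker intermediate, decompositions, Liouville split),
with the trivial compositions kernel-checked. Nothing here is filed as an item; the open pieces are
`def`s (Props), never `sorry`d theorems.
-/

namespace Summit.NavierStokesRegularity.NavierStokesRegularity.Cruxes.AxisymmetricKatoGlobal.StrategistS3

open MeasureTheory Set Function
open Literature.Analysis Literature.Analysis.FluidPDE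
open Summit.NavierStokesRegularity.NavierStokesRegularity.Theses.AxisymmetricExtremality

local notation "ℝ³" => EuclideanSpace ℝ (Fin 3)
local notation "ℂ³" => EuclideanSpace ℂ (Fin 3)

/-- The route's unfolded axisymmetry clause (`IsAxisymmetric u₀` by `Iff.rfl`). -/
def AxisymClause (u₀ : ℝ³ → ℝ³) : Prop :=
  ∀ (θ : ℝ) (x : ℝ³), u₀ (WithLp.toLp 2 ![Real.cos θ * x 0 - Real.sin θ * x 1,
      Real.sin θ * x 0 + Real.cos θ * x 1, x 2]) =
    WithLp.toLp 2 ![Real.cos θ * u₀ x 0 - Real.sin θ * u₀ x 1,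
      Real.sin θ * u₀ x 0 + Real.cos θ * u₀ x 1, u₀ x 2]

/-- A critical axisymmetric Kato blow-up datum at viscosity `ν` (the negation instance of the crux). -/
def IsAxisymKatoBlowupDatum (ν : ℝ) (u₀ : ℝ³ → ℝ³)
    (g : FunctionSpaces.HomSobolev ℝ³ ℂ³ (1 / 2 : ℝ)) : Prop :=
  MemLp u₀ 3 ∧ g.Represents (FunctionSpaces.EuclideanSpace.complexify ∘ u₀) ∧
    IsWeaklyDivFree u₀ ∧ AxisymClause u₀ ∧ ¬ HasGlobalKatoSolution ν u₀

theorem akg_iff_no_blowup_datum :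
    AxisymmetricKatoGlobal ↔ ∀ ν : ℝ, 0 < ν → ∀ u₀ g, ¬ IsAxisymKatoBlowupDatum ν u₀ g := by
  constructor
  · rintro h ν hν u₀ g ⟨hL3, hrep, hdiv, hax, hnot⟩
    exact hnot (h ν hν u₀ g hL3 hrep hdiv hax)
  · intro h ν hν u₀ g hL3 hrep hdiv hax
    by_contra hnot
    exact h ν hν u₀ g ⟨hL3, hrep, hdiv, hax, hnot⟩

/-! ## (1) Weaker intermediate actually consumed by `closes`: the threshold instance T₀ -/

/-- **T₀ (NAMB).** No axisymmetric Rusin–Šverák-minimal blow-up datum. Strictly weaker than the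
crux *as typed* (it only speaks about data of `Ḣ^{1/2}`-norm exactly `ρ_max^pure(ν)`), and it is
literally all that `closes` uses of `h₃`. -/
def NoAxisymMinimalBlowup : Prop :=
  ∀ ν : ℝ, 0 < ν → ∀ (u₀ : ℝ³ → ℝ³) (g : FunctionSpaces.HomSobolev ℝ³ ℂ³ (1 / 2 : ℝ)),
    IsMinimalBlowupDatum ν u₀ g → AxisymClause u₀ → False

theorem noAxisymMinimalBlowup_of_akg (h : AxisymmetricKatoGlobal) : NoAxisymMinimalBlowup := by
  intro ν hν u₀ g hmin hax
  obtain ⟨hL3, hrep, hdiv, -, hnot⟩ := hmin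
  exact hnot (h ν hν u₀ g hL3 hrep hdiv hax)

/-- The route closes from T₀ in place of the crux (same proof as the route's `closes`). -/
theorem closes_of_T0 (h₂ : MinimalDatumPFold) (h₄ : PFoldToAxisymmetric)
    (h₃ : NoAxisymMinimalBlowup) : NavierStokesRegularity := by
  show Literature.NS.NavierStokesExistenceSmoothR3
  intro ν hν u₀ hsm hdiv hdec
  by_contra hno
  obtain ⟨u₁, g, hmin, hax⟩ := h₄ ν hν (h₂ ν hν ⟨u₀, hsm, hdiv, hdec, hno⟩)
  exact h₃ ν hν u₁ g hmin hax

/-! ## (2e) Decomposition through classical data: AKG ⇐ AX_Schwartz-Kato ∧ Transcription -/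

/-- **AX in Kato form on Clay data** (ns.S25 with the conclusion in the Kato class). -/
def AxisymSchwartzKatoGlobal : Prop :=
  ∀ ν : ℝ, 0 < ν → ∀ u₀ : ℝ³ → ℝ³, ContDiff ℝ (⊤ : ℕ∞) u₀ → NSWave0.IsDivFree u₀ →
    HasRapidSpatialDecay u₀ → AxisymClause u₀ → HasGlobalKatoSolution ν u₀

/-- **Axisymmetric transcription** (the axisymmetric case of `RusinSverakQuestion`-type
statements): an axisymmetric critical Kato blow-up datum yields an axisymmetric *Clay* (smooth,
divergence-free, rapidly decaying) Kato blow-up datum at the same viscosity. Open. -/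
def AxisymTranscription : Prop :=
  ∀ ν : ℝ, 0 < ν →
    (∃ u₀ g, IsAxisymKatoBlowupDatum ν u₀ g) →
      ∃ v₀ : ℝ³ → ℝ³, ContDiff ℝ (⊤ : ℕ∞) v₀ ∧ NSWave0.IsDivFree v₀ ∧ HasRapidSpatialDecay v₀ ∧
        AxisymClause v₀ ∧ ¬ HasGlobalKatoSolution ν v₀

theorem akg_of_schwartz_and_transcription (hS : AxisymSchwartzKatoGlobal)
    (hT : AxisymTranscription) : AxisymmetricKatoGlobal := by
  rw [akg_iff_no_blowup_datum]
  intro ν hν u₀ g hbad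
  obtain ⟨v₀, hsm, hdiv, hdec, hax, hnot⟩ := hT ν hν ⟨u₀, g, hbad⟩
  exact hnot (hS ν hν v₀ hsm hdiv hdec hax)

/-! ## (2f') Liouville split, typed so that the Type II gap is visible -/

/-- Slice-wise constancy (the conclusion of the Liouville conjecture, tree rendering). -/
def IsSliceConstant (U : ℝ → ℝ³ → ℝ³) : Prop :=
  ∀ t < 0, ∃ b : ℝ³, U t =ᵐ[volume] fun _ => b

/-- Bounded ancient mild, measurable slices, axisymmetric about the `x₂`-axis, bounded swirl. -/
def InBoundedSwirlAxisymClass (U : ℝ → ℝ³ → ℝ³) : Prop :=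
  IsBoundedAncientMildSolution 1 U ∧ (∀ t < 0, AEStronglyMeasurable (U t) volume) ∧
    (∀ t < 0, IsAxisymmetric (U t)) ∧ ∃ C : ℝ, ∀ t < 0, ∀ x, |swirl (U t) x| ≤ C

/-- Bounded ancient mild, measurable slices, independent of the `x₁` direction ("2.5D"). -/
def InPlanarClass (U : ℝ → ℝ³ → ℝ³) : Prop :=
  IsBoundedAncientMildSolution 1 U ∧ (∀ t < 0, AEStronglyMeasurable (U t) volume) ∧
    ∀ t < 0, ∀ (x : ℝ³) (s : ℝ), U t (x + s • EuclideanSpace.single 1 1) = U t x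

/-- **L_Γ** — the bounded-swirl axisymmetric Liouville conjecture (KNSS 2009 conjecture restricted
to axisymmetric fields with `Γ ∈ L^∞`; partial results Lei–Zhang–Zhao `Γ ∈ L^∞_t L^p_x`,
Lei–Ren–Zhang z-periodic, Lei–Ren–Zhang rate-to-max). Open. -/
def BoundedSwirlAxisymLiouville : Prop :=
  ∀ U, InBoundedSwirlAxisymClass U → IsSliceConstant U

/-- **Planar Liouville with a passive third component** (KNSS 2009 Thm 5.1 + heat-equation
Liouville; in print, KNSS §6 / Lei–Zhang 2011 §4). -/
def PlanarLiouville : Prop :=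
  ∀ U, InPlanarClass U → IsSliceConstant U

/-- **R_II — the blow-up-limit piece.** Every axisymmetric critical Kato blow-up produces a
NONCONSTANT bounded ancient mild solution in one of the two Liouville classes. This is where the
Type II gap sits: the sup-rescaling limit of a Type II blow-up may be constant. -/
def BlowupLimitNonconstant : Prop :=
  ∀ ν : ℝ, 0 < ν → ∀ u₀ g, IsAxisymKatoBlowupDatum ν u₀ g →
    ∃ U, (InBoundedSwirlAxisymClass U ∨ InPlanarClass U) ∧ ¬ IsSliceConstant U

theorem akg_of_liouville_split (hR : BlowupLimitNonconstant) (hL : BoundedSwirlAxisymLiouville)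
    (hP : PlanarLiouville) : AxisymmetricKatoGlobal := by
  rw [akg_iff_no_blowup_datum]
  intro ν hν u₀ g hbad
  obtain ⟨U, hU | hU, hnc⟩ := hR ν hν u₀ g hbad
  · exact hnc (hL U hU)
  · exact hnc (hP U hU)

end Summit.NavierStokesRegularity.NavierStokesRegularity.Cruxes.AxisymmetricKatoGlobal.StrategistS3
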